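/-
Width seat `ym-line-cbag-p1-w2` (prover-ym-line-cbag-p1-w2-g2-0; own items 22254/22893 closed), route `ColdBoxAllGroups`, helping crux
`BulkAllGroups` (stmt-QuantumFields-22255), line `dlr-chessboard-G` (lead `ym-line-cbag-p2`): the YM-side good event AT THE CHARTED
CONFIGURATION `W = forestFix (truncated gauge copy)` — B5-G/H-T6-G transported through the kernel bridge.
-/
import Summits.QuantumFields.YangMills.Theorems.ColdBoxAllGroupsBulkAllGroupsKernelBridgeG
import Summits.QuantumFields.YangMills.Theorems.ColdBoxAllGroupsBulkAllGroupsKernelGoodEventG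
import Summits.QuantumFields.YangMills.Theorems.ColdBoxAllGroupsOneScaleDefs

/-!
# Crux `BulkAllGroups` (stmt-QuantumFields-22255), stubs N2-cov-G / N2-mean-G: the small-field event of the cold box under the kernel with the
# FOREST-FIXED TRUNCATED GAUGE COPY of a crude-good datum (hypotheses `hG0` / `hpY` of T3-datum and of the cores, at `W`)

The representation with datum (`integral_cond_boxKernelG_eq_integral_tilted_datum'`, lead p2) and the cores are stated for the kernel
`boxKernelG ρ β H W` of the CHARTED configuration `W = forestFix H (glueWith E ((ω^g)|_E) 1)` of the datum package, whereas the YM-side rarity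
B5-G / H-T6-G (`boxKernelG_real_coldGoodSetG_compl_le`, `…KernelGoodEventG`) is stated at the crude-good datum `ω`.  The large-field event of the
collar is gauge invariant and local to the enlarged box, so the kernel bridge (`measureReal_largeField_boxKernelG_eq_of_gauge_trunc`,
`…KernelBridgeG`) moves the bound across:
* `coldGoodSetG_compl_eq` — `(coldGoodSetG ρ H β ε)ᶜ` is the collar large-field event at threshold `β^{2ε−1}`;
* `measureReal_coldGoodSetG_compl_boxKernelG_eq_of_gauge_trunc` — same kernel mass of the bad event at `ω` and at `W` (every gauge `g`);
* **`boxKernelG_real_coldGoodSetG_compl_le_trunc`** — for `0 < θ`, `0 ≤ δ`, `3θ + δ < ε`, eventually in `β`: for every crude-good `ω` and every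
  gauge `g`, `(boxKernelG ρ β H W).real (coldGoodSetG ρ H β ε)ᶜ ≤ e^{−β^ε}` (`H = ⌈β^θ⌉`) — hypothesis `(hpY)`;
* `boxKernelG_coldGoodSetG_ne_zero_trunc` — hence the good event is charged by the kernel at `W` — hypothesis `(hG0)`;
* `abs_boxKernelG_integral_sub_cond_le_trunc` / `abs_boxKernelG_cov_sub_cond_le_trunc` — the YM conditioning bounds at `W` (means `2M e^{−β^ε}`,
  covariances `6 M_f M_g e^{−β^ε}`), uniformly over crude-good `ω` and gauges `g`.
No sorry; no definition; standard axioms.  NOT a claim about the mass gap: rung-level support (R2xi-G `XiPow`, RECORD label); the Yang–Mills mass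
gap is NOT proved by any of this.
-/

set_option autoImplicit false

noncomputable section

open MeasureTheory ProbabilityTheory Finset Real
open Literature.Probability.LatticeModels
open Literature.MathematicalPhysics.QuantumLattice
open Literature.MathematicalPhysics.QuantumFieldTheory
open Literature.MathematicalPhysics.QuantumFieldTheory.AxialGauge
open Literature.MathematicalPhysics.QuantumFieldTheory.LatticeMaxwell
open Summit.QuantumFields.YangMills.Theorems.WeakCouplingRates

namespace Summit.QuantumFields.YangMills.Theorems.ColdBoxAllGroups

variable {N : ℕ} [NeZero N] {G : Type*} [Group G] [TopologicalSpace G] [IsTopologicalGroup G] [CompactSpace G]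
  [MeasurableSpace G] [BorelSpace G] [SecondCountableTopology G]
variable (ρ : G →* Matrix (Fin N) (Fin N) ℂ) (hρu : ∀ g, ρ g ∈ Matrix.unitaryGroup (Fin N) ℂ) (hρc : Continuous ρ)

omit [NeZero N] [TopologicalSpace G] [IsTopologicalGroup G] [CompactSpace G] [MeasurableSpace G] [BorelSpace G]
  [SecondCountableTopology G] in
/-- The complement of the good event is the collar large-field event at threshold `β^{2ε−1}`. [folklore] -/
theorem coldGoodSetG_compl_eq (H : ℕ) (β ε : ℝ) :
    (coldGoodSetG ρ H β ε)ᶜ = {U : LGConfig 4 G | ∃ p ∈ plaquettesTouching (boxEdges 4 (2 * H + 1)),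
      β ^ (2 * ε - 1) ≤ (N : ℝ) - plaquetteObs ρ p.1 p.2.1.1 p.2.1.2 U} := by
  rw [coldGoodSetG, compl_compl]

omit [NeZero N] in
include hρc in
/-- **The kernel mass of the bad event is the same at `ω` and at the forest-fixed truncated gauge copy `W`** (every gauge `g`). -/
theorem measureReal_coldGoodSetG_compl_boxKernelG_eq_of_gauge_trunc (β ε : ℝ) (H : ℕ) (ω : LGConfig 4 G) (g : Site 4 → G) :
    (boxKernelG ρ β H ω).real (coldGoodSetG ρ H β ε)ᶜ =
      (boxKernelG ρ β H
        (forestFix H (glueWith (boxEdgesAt dirCorner (2 * H + 3))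
          (fun e' : ↥(boxEdgesAt dirCorner (2 * H + 3)) => gaugeTransformZd g ω e'.1) (fun _ => 1)))).real (coldGoodSetG ρ H β ε)ᶜ := by
  rw [coldGoodSetG_compl_eq]
  exact measureReal_largeField_boxKernelG_eq_of_gauge_trunc ρ hρc β _ H ω g

include hρu hρc in
/-- **(hpY at `W`) Large fields under the kernel of the charted configuration, uniformly over crude-good data and gauges**: for `0 < θ`,
`0 ≤ δ`, `3θ + δ < ε`, eventually in `β`, for every crude-good `ω` and every gauge `g`,
`(boxKernelG ρ β H W).real (coldGoodSetG ρ H β ε)ᶜ ≤ e^{−β^ε}`, `W = forestFix H (glueWith E ((ω^g)|_E) 1)`, `H = ⌈β^θ⌉`. -/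
theorem boxKernelG_real_coldGoodSetG_compl_le_trunc {θ δ ε : ℝ} (hθ : 0 < θ) (hδ : 0 ≤ δ) (hε : 3 * θ + δ < ε) :
    ∃ β₀ : ℝ, ∀ β : ℝ, β₀ ≤ β → ∀ ω : LGConfig 4 G, CrudeGoodG ρ β δ ⌈β ^ θ⌉₊ ω → ∀ g : Site 4 → G,
      (boxKernelG ρ β ⌈β ^ θ⌉₊
        (forestFix ⌈β ^ θ⌉₊ (glueWith (boxEdgesAt dirCorner (2 * ⌈β ^ θ⌉₊ + 3))
          (fun e' : ↥(boxEdgesAt dirCorner (2 * ⌈β ^ θ⌉₊ + 3)) => gaugeTransformZd g ω e'.1) (fun _ => 1)))).real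
        (coldGoodSetG ρ ⌈β ^ θ⌉₊ β ε)ᶜ ≤ Real.exp (-(β ^ ε)) := by
  obtain ⟨β₀, hβ₀⟩ := boxKernelG_real_coldGoodSetG_compl_le ρ hρu hρc hθ hδ hε
  refine ⟨β₀, fun β hβ ω hω g => ?_⟩
  rw [← measureReal_coldGoodSetG_compl_boxKernelG_eq_of_gauge_trunc ρ hρc β ε _ ω g]
  exact hβ₀ β hβ ω hω

include hρu hρc in
/-- **(hG0 at `W`) The good event is charged by the kernel of the charted configuration**, eventually in `β` (`β > 0` there), uniformly over
crude-good data and gauges. -/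
theorem boxKernelG_coldGoodSetG_ne_zero_trunc {θ δ ε : ℝ} (hθ : 0 < θ) (hδ : 0 ≤ δ) (hε : 3 * θ + δ < ε) :
    ∃ β₀ : ℝ, ∀ β : ℝ, β₀ ≤ β → ∀ ω : LGConfig 4 G, CrudeGoodG ρ β δ ⌈β ^ θ⌉₊ ω → ∀ g : Site 4 → G,
      boxKernelG ρ β ⌈β ^ θ⌉₊
        (forestFix ⌈β ^ θ⌉₊ (glueWith (boxEdgesAt dirCorner (2 * ⌈β ^ θ⌉₊ + 3))
          (fun e' : ↥(boxEdgesAt dirCorner (2 * ⌈β ^ θ⌉₊ + 3)) => gaugeTransformZd g ω e'.1) (fun _ => 1)))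
        (coldGoodSetG ρ ⌈β ^ θ⌉₊ β ε) ≠ 0 := by
  obtain ⟨β₀, hβ₀⟩ := boxKernelG_real_coldGoodSetG_compl_le_trunc ρ hρu hρc hθ hδ hε
  refine ⟨max β₀ 1, fun β hβ ω hω g => ?_⟩
  have hb0 : β₀ ≤ β := (le_max_left _ _).trans hβ
  have hβ1 : (1 : ℝ) ≤ β := (le_max_right _ _).trans hβ
  exact boxKernelG_coldGoodSetG_ne_zero ρ hρc (by linarith) (hβ₀ β hb0 ω hω g)

include hρu hρc in
/-- **YM conditioning of means at `W`**: eventually in `β`, for every crude-good `ω`, gauge `g` and bounded measurable `f`,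
`|E_{γ(·|W)} f − E_{γ(·|W)}[f | good]| ≤ 2 M_f e^{−β^ε}`. -/
theorem abs_boxKernelG_integral_sub_cond_le_trunc {θ δ ε : ℝ} (hθ : 0 < θ) (hδ : 0 ≤ δ) (hε : 3 * θ + δ < ε) :
    ∃ β₀ : ℝ, ∀ β : ℝ, β₀ ≤ β → ∀ ω : LGConfig 4 G, CrudeGoodG ρ β δ ⌈β ^ θ⌉₊ ω → ∀ g : Site 4 → G,
      ∀ (f : LGConfig 4 G → ℝ) (Mf : ℝ), Measurable f → (∀ U, |f U| ≤ Mf) →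
        |(∫ U, f U ∂(boxKernelG ρ β ⌈β ^ θ⌉₊
            (forestFix ⌈β ^ θ⌉₊ (glueWith (boxEdgesAt dirCorner (2 * ⌈β ^ θ⌉₊ + 3))
              (fun e' : ↥(boxEdgesAt dirCorner (2 * ⌈β ^ θ⌉₊ + 3)) => gaugeTransformZd g ω e'.1) (fun _ => 1))))) -
          ∫ U, f U ∂((boxKernelG ρ β ⌈β ^ θ⌉₊
            (forestFix ⌈β ^ θ⌉₊ (glueWith (boxEdgesAt dirCorner (2 * ⌈β ^ θ⌉₊ + 3))
              (fun e' : ↥(boxEdgesAt dirCorner (2 * ⌈β ^ θ⌉₊ + 3)) => gaugeTransformZd g ω e'.1) (fun _ => 1))))[|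
              coldGoodSetG ρ ⌈β ^ θ⌉₊ β ε])| ≤
          2 * Mf * Real.exp (-(β ^ ε)) := by
  obtain ⟨β₀, hβ₀⟩ := boxKernelG_real_coldGoodSetG_compl_le_trunc ρ hρu hρc hθ hδ hε
  refine ⟨max β₀ 1, fun β hβ ω hω g f Mf hfm hM => ?_⟩
  have hb0 : β₀ ≤ β := (le_max_left _ _).trans hβ
  have hβ1 : (1 : ℝ) ≤ β := (le_max_right _ _).trans hβ
  set W := forestFix ⌈β ^ θ⌉₊ (glueWith (boxEdgesAt dirCorner (2 * ⌈β ^ θ⌉₊ + 3))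
    (fun e' : ↥(boxEdgesAt dirCorner (2 * ⌈β ^ θ⌉₊ + 3)) => gaugeTransformZd g ω e'.1) (fun _ => 1)) with hW
  set μ := boxKernelG ρ β ⌈β ^ θ⌉₊ W with hμ
  haveI : IsProbabilityMeasure μ := isProbabilityMeasure_boxKernelG ρ hρc β _ W
  have hbad : μ.real (coldGoodSetG ρ ⌈β ^ θ⌉₊ β ε)ᶜ ≤ Real.exp (-(β ^ ε)) := hβ₀ β hb0 ω hω g
  have hG0 : μ (coldGoodSetG ρ ⌈β ^ θ⌉₊ β ε) ≠ 0 := boxKernelG_coldGoodSetG_ne_zero ρ hρc (by linarith) hbad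
  have hMf0 : 0 ≤ Mf := (abs_nonneg _).trans (hM fun _ => 1)
  have hfi : Integrable f μ := integrable_of_bound hfm.aestronglyMeasurable hM
  have key := abs_integral_sub_integral_cond_le (μ := μ) (measurableSet_coldGoodSetG ρ hρc β ε) hG0 hfi hM
  calc _ ≤ 2 * Mf * μ.real (coldGoodSetG ρ ⌈β ^ θ⌉₊ β ε)ᶜ := key
    _ ≤ 2 * Mf * Real.exp (-(β ^ ε)) := mul_le_mul_of_nonneg_left hbad (by positivity)

end Summit.QuantumFields.YangMills.Theorems.ColdBoxAllGroups

end
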